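import Literature.Barriers.CriticalPhenomena.WeaklySAWPerturbativeFlow
import Literature.Barriers.CriticalPhenomena.WeaklySAWFlowContinuity
import HarnessLib

/-!
# BBS 2015, Theorem 7.2.1(i) and Corollary 7.2.2 for the 4d weakly self-avoiding walk, modulo (A3):
# the hypotheses (A1–A2) of [BBS-rg-flow, Theorem 1.4] are DISCHARGED for the explicit flow map `φ̄`

Source: Bauerschmidt–Brydges–Slade, CMP 337 (2015) [BBS2015], §7.2: "The following theorem is a
restatement of the main result of [BBS-rg-flow, Theorem 1.4] (Theorem 7.2.1) … Assume (A1–A3) …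
(i) … there exists a unique global flow …"; Corollary 7.2.2 = [BBS-rg-flow, Corollary 1.8]
(continuity of the critical initial condition in an external parameter and in `(K₀, g₀)`); and
§7.3, Step 1 of the proof of Proposition 7.1.1: "By Proposition 6.1.1, `φ̄` satisfies (A1)–(A2)" —
the remaining hypothesis (A3) being the content of [BS-rg-step] (BBS 2015, Theorems 6.4.1 and 6.5.1
combined with the transformation `T_j` of §6.1).

In this tree [BBS-rg-flow, Theorem 1.4(i)] is `BBS_thm14_exists_flow` and [BBS-rg-flow, Corollary 1.8]
is `critFlow_continuousWithinAt` (both for an ABSTRACT quadratic flow `P : QuadFlowParams` under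
`HypA1`, `HypA2`, `HypA3`); `WeaklySAWPerturbativeA2.lean` proves `HypA1 ∧ HypA2` for the explicit
`P = wsawQuadFlow L m²` (`d = 4`, `λ = L²`) uniformly in `m² ∈ [0, δ]`, and
`WeaklySAWPerturbativeFlow.lean` the joint continuity of its coefficients in `m²`. This file only
ASSEMBLES these: it is the precise form of "Theorem 7.2.1(i) and Corollary 7.2.2 apply to the weakly
self-avoiding walk as soon as the RG map satisfies (A3)".

## What this file provides

* `massParams L δ` — the index type `[0, δ]` of external parameters with `Pf m = wsawQuadFlow L m`;
* **`BBS2015_hypA12_package`** — `∃ δ B c C`, `0 < δ ≤ 1`, with `HypA1 ∧ HypA2` for every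
  `m² ∈ [0, δ]` (same constants) and `CoeffContinuous` of `m² ↦ wsawQuadFlow L m²` on `[0, δ]`;
* **`BBS2015_thm721_i_of_hypA3`** — Theorem 7.2.1(i) for WSAW: for `m² ∈ [0,δ]`, constants as in
  [BBS-rg-flow, Theorem 1.4], `0 < g₀ ≤ g_threshold`, `‖K₀‖ ≤ a_*g₀³` and ANY spaces/maps
  `(𝒲_j, ψ_j, ρ_j)` satisfying (A3) along `V̄(m², g₀)`: existence and uniqueness of the global flow with
  `(z_∞, μ_∞) = 0` and the bounds (gjbd)–(e:VVbar2);
* **`BBS2015_cor722_of_hypA3`** — Corollary 7.2.2 for WSAW: continuity of the critical flow (hence of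
  `(z₀ᶜ, μ₀ᶜ)`) in `(m², K₀, g₀)` within the admissible set, given (A3) on that set, the joint
  continuity of `(ψ, ρ)` in `(m², x)` and the continuity of `χ_j(m²)` at the base point (the explicit
  hypotheses of the tree's Corollary 1.8).
-/

noncomputable section

open Set Filter Topology

namespace Literature.Barriers.CriticalPhenomena

namespace CTWSAW

/-- The external parameters `m² ∈ [0, δ]` of the weakly self-avoiding walk flow.
[cite: BauerschmidtBrydgesSlade2015LogCorr, §7.1 ("m² ∈ 𝕀₊ = [0,δ]") and Corollary 7.2.2 (M_ext)] -/
abbrev massParams (δ : ℝ) : Type := ↥(Icc (0 : ℝ) δ)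

/-- **(A1–A2) and the continuity of the coefficients for `φ̄` of the 4d weakly SAW, packaged**:
`∃ δ ∈ (0,1]`, `B, c, C` with `HypA1 ∧ HypA2` for `wsawQuadFlow L m²` at every `m² ∈ [0,δ]` and
`m² ↦ wsawQuadFlow L m²` coefficientwise continuous on `[0,δ]` ("By Proposition 6.1.1, `φ̄` satisfies
(A1)–(A2)"; "continuity of `β_j, θ_j, …` in the mass"). [cite: BauerschmidtBrydgesSlade2015LogCorr, Proposition 6.1.1 and §7.3 (Step 1)] -/
theorem BBS2015_hypA12_package {L : ℝ} (hL : 2 ≤ L) {Ω : ℝ} (hΩ : 1 < Ω) :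
    ∃ δ B c C : ℝ, 0 < δ ∧ δ ≤ 1 ∧
      (∀ m : massParams δ, HypA1 (wsawQuadFlow L (m : ℝ)).β Ω B c ∧ HypA2 (wsawQuadFlow L (m : ℝ)) Ω (L ^ 2) c C) ∧
      CoeffContinuous (fun m : massParams δ => wsawQuadFlow L (m : ℝ)) := by
  obtain ⟨δ, B, c, C, hδ, hδ1, hA⟩ := hypA1_and_hypA2_wsawQuadFlow hL hΩ
  refine ⟨δ, B, c, C, hδ, hδ1, fun m => hA m m.2.1 m.2.2, ?_⟩
  exact coeffContinuous_wsawQuadFlow (by linarith) (fun s hs => hs.1)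

/-- **BBS 2015, Theorem 7.2.1(i), for the 4d weakly self-avoiding walk, modulo (A3)**: let `L ≥ 2`,
`Ω > 1`, and `δ, B, c, C` as in `BBS2015_hypA12_package`; let the constants satisfy
`0 < κ < Ω⁻¹`, `R, M > 0`, `R/(1-κΩ) < a_* < a`, `0 < b < 1`, `𝗁 ≥ 𝗁_threshold`. Then for every
`m² ∈ [0,δ]`, every `0 < g₀ ≤ g_threshold`, every family of Banach spaces `𝒲_j` and maps
`ψ_j : 𝒲_j × 𝒱 → 𝒲_{j+1}`, `ρ_j : 𝒲_j × 𝒱 → 𝒱` satisfying (A3) along `V̄ = V̄(m², g₀)`, and every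
`‖K₀‖ ≤ a_*g₀³`, there is a UNIQUE global flow `(K_j, V_j)` of `Φ = (ψ, φ̄ + ρ)` with `(K₀, g₀)`
prescribed, `(z_∞, μ_∞) = (0,0)`, in the domains `D_j`, obeying the bounds (gjbd)–(e:VVbar2).
[cite: BauerschmidtBrydgesSlade2015LogCorr, Theorem 7.2.1(i)] [cite: BauerschmidtBrydgesSlade2015Flow, Theorem 1.4(i)] -/
theorem BBS2015_thm721_i_of_hypA3 {L : ℝ} {Ω B c C : ℝ} (hΩ : 1 < Ω) {s : ℝ}
    (hA : HypA1 (wsawQuadFlow L s).β Ω B c ∧ HypA2 (wsawQuadFlow L s) Ω (L ^ 2) c C)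
    {a κ R M aStar b : ℝ} (hκ : 0 < κ) (hκΩ : κ * Ω < 1) (hR : 0 < R) (hM : 0 < M)
    (haStar : R / (1 - κ * Ω) < aStar) (ha : aStar < a) (hb : 0 < b) (hb1 : b < 1) (hh : ℝ)
    (hhh : hThreshold Ω c C (L ^ 2) M a aStar κ b ≤ hh)
    {W : ℕ → Type*} [∀ j, NormedAddCommGroup (W j)] [∀ j, NormedSpace ℝ (W j)] [∀ j, CompleteSpace (W j)]
    (ψ : ∀ j, W j × V3 → W (j + 1)) (ρ : ∀ j, W j × V3 → V3) {g₀ : ℝ} {K₀ : W 0} (hg₀ : 0 < g₀)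
    (hgs : g₀ ≤ gThreshold Ω B c C (L ^ 2) M a aStar κ R b hh)
    (hA3 : HypA3 (chi (wsawQuadFlow L s).β Ω) ψ ρ ((wsawQuadFlow L s).flow g₀) a hh κ Ω R M)
    (hK₀ : ‖K₀‖ ≤ aStar * g₀ ^ 3) :
    ∃ x : ∀ j, W j × V3,
      (∀ j, x j ∈ flowDomain (chi (wsawQuadFlow L s).β Ω) ((wsawQuadFlow L s).flow g₀) a hh j) ∧
      IsPerturbedFlow (wsawQuadFlow L s) ψ ρ x ∧ (x 0).1 = K₀ ∧ (x 0).2 0 = g₀ ∧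
      Tendsto (fun j => (x j).2 1) atTop (𝓝 0) ∧ Tendsto (fun j => (x j).2 2) atTop (𝓝 0) ∧
      FlowBounds (chi (wsawQuadFlow L s).β Ω) ψ ((wsawQuadFlow L s).flow g₀) K₀ a aStar hh b x ∧
      ∀ x' : ∀ j, W j × V3, IsPerturbedFlow (wsawQuadFlow L s) ψ ρ x' → (x' 0).1 = K₀ → (x' 0).2 0 = g₀ →
        Tendsto (fun j => (x' j).2 1) atTop (𝓝 0) → Tendsto (fun j => (x' j).2 2) atTop (𝓝 0) →
        FlowBounds (chi (wsawQuadFlow L s).β Ω) ψ ((wsawQuadFlow L s).flow g₀) K₀ a aStar hh b x' → x' = x :=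
  BBS_thm14_exists_flow hΩ hκ hκΩ hR hM haStar ha hb hb1 hh hhh (wsawQuadFlow L s) ψ ρ hA.1 hA.2 hg₀ hgs hA3 hK₀

/-- **BBS 2015, Corollary 7.2.2, for the 4d weakly self-avoiding walk, modulo (A3)**: with the
external parameter `m² ∈ M_ext = [0,δ]`, `Pf m² = φ̄(m²)` (the explicit `wsawQuadFlow`, for which
(A1–A2) hold uniformly and the coefficients are continuous in `m²`), maps `ψ(m²), ρ(m²)` jointly
continuous in `(m², x)` on the domains, and `χ_j(·)` continuous at the base mass: the critical flow
`x(m², K₀, g₀)` — in particular `(z₀ᶜ, μ₀ᶜ)(m², K₀, g₀) = (x₀).2` — is continuous at every admissible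
`(m², K₀, g₀)` within the admissible set (where (A3) holds).
[cite: BauerschmidtBrydgesSlade2015LogCorr, Corollary 7.2.2] [cite: BauerschmidtBrydgesSlade2015Flow, Corollary 1.8] -/
theorem BBS2015_cor722_of_hypA3 {L : ℝ} (hL : 2 ≤ L) {δ Ω B c C : ℝ}
    (hA : ∀ m : massParams δ, HypA1 (wsawQuadFlow L (m : ℝ)).β Ω B c ∧ HypA2 (wsawQuadFlow L (m : ℝ)) Ω (L ^ 2) c C)
    {a κ R M aStar b hh : ℝ} (hc : ConstHyp Ω c (L ^ 2) C a κ R M aStar b hh)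
    {W : ℕ → Type*} [∀ j, NormedAddCommGroup (W j)] [∀ j, NormedSpace ℝ (W j)] [∀ j, CompleteSpace (W j)]
    (ψf : ∀ m : massParams δ, ∀ j, W j × V3 → W (j + 1)) (ρf : ∀ m : massParams δ, ∀ j, W j × V3 → V3)
    (hψ : ∀ (j : ℕ) (m : massParams δ) (g : ℝ) (x : W j × V3),
      x ∈ flowDomain (chi (wsawQuadFlow L (m : ℝ)).β Ω) ((wsawQuadFlow L (m : ℝ)).flow g) a hh j →
      ContinuousAt (fun p : massParams δ × (W j × V3) => ψf p.1 j p.2) (m, x))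
    (hρ : ∀ (j : ℕ) (m : massParams δ) (g : ℝ) (x : W j × V3),
      x ∈ flowDomain (chi (wsawQuadFlow L (m : ℝ)).β Ω) ((wsawQuadFlow L (m : ℝ)).flow g) a hh j →
      ContinuousAt (fun p : massParams δ × (W j × V3) => ρf p.1 j p.2) (m, x))
    {q₀ : massParams δ × (W 0 × ℝ)}
    (hq₀ : Adm (fun m : massParams δ => wsawQuadFlow L (m : ℝ)) ψf ρf Ω B c (L ^ 2) C a κ R M aStar b hh q₀)
    (hχ : ∀ j, ContinuousAt (fun m : massParams δ => chi (wsawQuadFlow L (m : ℝ)).β Ω j) q₀.1) (j : ℕ) :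
    ContinuousWithinAt (fun q => critFlow ψf ρf hc hA q j)
      {q | Adm (fun m : massParams δ => wsawQuadFlow L (m : ℝ)) ψf ρf Ω B c (L ^ 2) C a κ R M aStar b hh q} q₀ :=
  critFlow_continuousWithinAt ψf ρf hc hA (coeffContinuous_wsawQuadFlow (by linarith) (fun s hs => hs.1))
    hψ hρ hq₀ hχ j

end CTWSAW

end Literature.Barriers.CriticalPhenomena
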